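import Summits.BirchSwinnertonDyer.BirchSwinnertonDyer.Theorems.GenusKolyvaginAtTwoK4NegOfWallRowsU2AlphaOrNonPhantom
import Summits.BirchSwinnertonDyer.BirchSwinnertonDyer.Theorems.GenusKolyvaginAtTwoK4NegPhantomTwinTraceDictionary
import HarnessLib

/-!
# Route `GenusKolyvaginAtTwo`, crux K₄⁻ `K4Neg` (stmt-BirchSwinnertonDyer-31526) — K4Neg AT A FRAME ⟸ WALL row 1 + U₂ + Q2 + PRINT under
# the STEERING BINDER (director (677) `K4NegSteered`), under LINE 38's `SteerAt`, and under LINE 37's twin bit `𝒩(Wd)` — by-name closers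

Width seat `bsd-line-gk2-p4` g35 (cell `bsd-f1-sign2`), `--supports stmt-BirchSwinnertonDyer-31526 --as helper`; glue on top of the LEAD's
closers (gk2-p1 g29, `…K4NegOfWallRowsU2AlphaOrNonPhantom`, p791338: K4Neg at a frame ⟸ items under (NPh_K) / bit TRUE / (α) datum /
`4 ∤ a_{ℓ₀}`) and this seat's dictionary (`…K4NegPhantomTwinTraceDictionary`: `𝒩(Wd) ⟺ SteerAt ⟺ «Selmer phantom ⟹ 4 ∤ a_{ℓ₀}»`).
THEOREMS ONLY; no `sorry`; standard axioms.  **BSD is NOT proved here; K4Neg is NOT proved; nothing is closed.**  Every theorem is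
CONDITIONAL on OPEN route items BY NAME (WALL rows 19095–19098 of `ByReductionTypeAtTwo`, U₂ `MinimalTwinBSDTwo` 22985, Q2
`KolyvaginRelationAtTwo` 24880, PRINT `GrossZagierAllLevels` / `MultPublishedInputsAtTwo` / `EntireLFunctionRat` / `MilneAnyModel`).

* ★ `kFourNeg_conclusion_of_wallRows_U2_of_steerBinder` — K4Neg's binders VERBATIM + items + **the (677) binder «every non-zero class of
  `Sel₂(E)` dying on `Γ_{ℚ(E[4])}` has `4 ∤ a_{ℓ₀}(E)`»** ⟹ K4Neg's conclusion.  (Case split on `4 ∣ a_{ℓ₀}`: if so, the binder says the curve is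
  bit-TRUE and the LEAD's §3 closer applies; if not, the LEAD's §5 closer.)  This is the by-name closer of the director's `K4NegSteered` in the
  trace-bit spelling — it covers BOTH the (α)-frames and every frame of a bit-TRUE curve, i.e. exactly the complement of the (β) residual.
* ★ `kFourNeg_conclusion_of_wallRows_U2_of_steerAt` — the same from LINE 38's `SteerAt W ℓ₀` (body verbatim: Selmer phantoms are ALIVE at `ℓ₀`),
  via gk2-p4 g34's prime-frame trace bit; so LINE 38's composition needs NEITHER stub H nor H₂ (`stub_halvingBit_of_twinHalves`): S1 alone.
* ★ `kFourNeg_conclusion_of_wallRows_U2_of_twinNonPhantomBit` — the same from LINE 37's `TwinNonPhantomBit Wd` (body verbatim, the pen's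
  `((2 : ℕ) : ℤ)` / `((4 : ℕ) : ℤ)` spelling), via ★★★ `forall_selmer_twist_eq_zero_iff_selmer_dying_imp_not_four_dvd`; so LINE 37's 𝒩-branch
  (`offCut_of_wall_U2_of_twinBit`) closes WITHOUT its stubs N1/N2 — LINE 37 reduces to its stub P = K4Neg|(β).

References: [LawsonWuthrich2016] §3, §7.1; [MazurRubin2010] Def. 3.1, Lemma 2.10–2.11, Prop. 3.3, Cor. 3.4 (i); [McCallumLMS1991] §5 Thm. 5.4;
[Kolyvagin1989Izv] Thm. B₂; [GrossLMS1991] §9 Prop. 9.6; [SilvermanAEC2009] Thm. V.2.3.1.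
-/

set_option autoImplicit false
-- the Theorems namespace of this sub repeats the summit name by design (D-0017 nested layout)
set_option linter.dupNamespace false

noncomputable section

open scoped Classical

namespace Summit.BirchSwinnertonDyer.BirchSwinnertonDyer.Theorems.GenusExact.PhantomDescentBit.TwinLevelFour

open WeierstrassCurve NumberField IsDedekindDomain Field Literature.NumberTheory.EllipticCurves
  Literature.NumberTheory.GaloisRepresentations Literature.NumberTheory.EllipticCurves.ModularForms
  Literature.NumberTheory.EllipticCurves.RingClassField Rat.HeightOneSpectrum
open Summit.BirchSwinnertonDyer.BirchSwinnertonDyer.Theses.GenusKolyvaginAtTwo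
  (KolyvaginRelationAtTwo GrossZagierAllLevels MultPublishedInputsAtTwo EntireLFunctionRat MilneAnyModel MinimalTwinBSDTwo)
open Summit.BirchSwinnertonDyer.BirchSwinnertonDyer.Theses.ByReductionTypeAtTwo
  (GoodOrdinaryRankZeroAtTwo MultiplicativeRankZeroAtTwo SupersingularRankZeroAtTwo AdditiveRankZeroAtTwo)
open Summit.BirchSwinnertonDyer.BirchSwinnertonDyer.Theorems.GenusExact

/-- ★ **K4Neg AT A FRAME ⟸ WALL row 1 + U₂ + Q2 + PRINT + THE STEERING BINDER** (director (677) `K4NegSteered`, trace-bit spelling): binders of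
`K4Neg` verbatim, the items, and «every non-zero class of `Sel₂(E)` dying on `Γ_{ℚ(E[4])}` has `4 ∤ a_{ℓ₀}(E)`».  If `4 ∣ a_{ℓ₀}` the binder makes
the curve bit-TRUE (no Selmer phantom) and the LEAD's §3 closer `kFourNeg_conclusion_of_wallRows_U2_of_forall_phantom_notMem_selmerGroup`
applies; otherwise the LEAD's §5 closer `kFourNeg_conclusion_of_wallRows_U2_of_not_four_dvd_frobeniusTrace`.  CONDITIONAL on OPEN route items;
BSD is NOT proved; K4Neg is NOT proved (its (β)-frames «Selmer phantom ∧ `4 ∣ a_{ℓ₀}`» are exactly what the binder excludes).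
[cite: LawsonWuthrich2016, §3, §7.1] [cite: McCallumLMS1991, §5 Thm. 5.4] [cite: MazurRubin2010, Cor. 3.4 (i)] -/
theorem kFourNeg_conclusion_of_wallRows_U2_of_steerBinder (hOrd : GoodOrdinaryRankZeroAtTwo)
    (hMult : MultiplicativeRankZeroAtTwo) (hSS : SupersingularRankZeroAtTwo) (hAdd : AdditiveRankZeroAtTwo) (hTw : MinimalTwinBSDTwo)
    (hQ2 : KolyvaginRelationAtTwo) (hGZ : GrossZagierAllLevels) (hGZK : MultPublishedInputsAtTwo) (hL : EntireLFunctionRat)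
    (hMi : MilneAnyModel)
    (W : WeierstrassCurve ℚ) [W.IsElliptic] [W.IsGloballyMinimal] [NeZero (W.conductorNorm ℤ)]
    (hcm : ¬ W.HasCM) (hr0 : W.analyticRank = 0) (hρ : ∀ n : ℕ, 0 < n → W.HasSurjectiveModNGaloisRep ((2 : ℤ) ^ n))
    (hT : Odd W.tamagawaProduct) (hneg : W.Δ < 0) (h4 : Nat.card (W.selmerGroup 2) = 4)
    (K : Type) [Field K] [NumberField K] (hIQ : IsImaginaryQuadratic K) (hodd : Odd (NumberField.discr K))
    (h3 : NumberField.discr K ≠ -3) (hHe : SatisfiesHeegnerHypothesis (W.conductorNorm ℤ) K)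
    (hsq1 : ¬ IsSquare ((NumberField.discr K : ℚ) * -|W.Δ|)) (hsq2 : ¬ IsSquare ((NumberField.discr K : ℚ) * (-(2 * |W.Δ|))))
    (ℓ₀ : ℕ) (hℓ₀ : ℓ₀.Prime) (hdK : NumberField.discr K = -(ℓ₀ : ℤ))
    (h2K : ((Ideal.span {(2 : ℤ)}).primesOver (𝓞 K)).ncard = 2)
    (Dt : ModularParametrizationData W (W.conductorNorm ℤ))
    (hopt : ∀ z ∈ Dt.L.lattice, ∃ w ∈ periodLattice Dt.f, z = (Dt.c : ℂ) * w) (hc : Odd Dt.c)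
    (β : ℤ) (ι : K →+* ℂ) (d₁ : KolyvaginHeegnerData Dt β ι 1) (hy : ¬ IsOfFinAddOrder d₁.derivedPoint)
    (M₀ : ℕ) (hdiv : ∃ Q : (W.baseChange (ringClassField K ι 1)).toAffine.Point, ((2 ^ M₀ : ℕ) : ℤ) • Q = d₁.derivedPoint)
    (hndiv : ¬ ∃ Q : (W.baseChange (ringClassField K ι 1)).toAffine.Point, ((2 ^ (M₀ + 1) : ℕ) : ℤ) • Q = d₁.derivedPoint)
    (hM₀ : 1 ≤ M₀)
    (Wd : WeierstrassCurve ℚ) [Wd.IsElliptic] [Wd.IsGloballyMinimal]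
    (hWd : ∃ C : VariableChange ℚ, C • W.quadraticTwist (NumberField.discr K : ℚ) = Wd)
    (hrd : Wd.analyticRank = 1) (hSel : Nat.card (Wd.selmerGroup 2) = 2) (hDEF : padicValNat 2 Wd.tamagawaProduct ≤ 1)
    (hsteer : ∀ y : galH1Torsion W (2 : ℤ), y ∈ W.selmerGroup 2 → y ≠ 0 →
      (∀ h ∈ torsionFixing W (4 : ℤ), h1Eval W (2 : ℤ) y h = 0) → ¬ (4 : ℤ) ∣ W.frobeniusTrace ℓ₀) :
    ∃ (n : ℕ) (d : KolyvaginHeegnerData Dt β ι n), Squarefree n ∧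
      (∀ ℓ ∈ n.primeFactors, Zhang2014.IsKolyvaginPrime (W.conductorNorm ℤ) W K 2 ℓ ∧ 2 ≤ Zhang2014.kolyvaginIndex W 2 ℓ ∧
        FrobEqFrobInfty W K 2 ℓ) ∧
      ¬ ∃ Q : (W.baseChange (ringClassField K ι n)).toAffine.Point, (2 : ℤ) • Q = d.derivedPoint := by
  by_cases hα : (4 : ℤ) ∣ W.frobeniusTrace ℓ₀
  · exact PlusDescent.kFourNeg_conclusion_of_wallRows_U2_of_forall_phantom_notMem_selmerGroup hOrd hMult hSS hAdd hTw hQ2 hGZ hGZK hL hMi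
      W hcm hr0 hρ hT hneg h4 K hIQ hodd h3 hHe hsq1 hsq2 ℓ₀ hℓ₀ hdK h2K Dt hopt hc β ι d₁ hy M₀ hdiv hndiv hM₀ Wd hWd hrd hSel hDEF
      (fun x hx0 hxd hxS ↦ hsteer x hxS hx0 hxd hα)
  · exact PlusDescent.kFourNeg_conclusion_of_wallRows_U2_of_not_four_dvd_frobeniusTrace hOrd hMult hSS hAdd hTw hQ2 hGZ hGZK hL hMi
      W hcm hr0 hρ hT hneg h4 K hIQ hodd h3 hHe hsq1 hsq2 ℓ₀ hℓ₀ hdK h2K Dt hopt hc β ι d₁ hy M₀ hdiv hndiv hM₀ Wd hWd hrd hSel hDEF hα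

/-- ★ **K4Neg AT A FRAME ⟸ WALL row 1 + U₂ + Q2 + PRINT + LINE 38's `SteerAt W ℓ₀`** (body verbatim: every non-zero class of `Sel₂(E)` dying on
`Γ_{ℚ(E[4])}` lies OUTSIDE `ker (H¹(ℚ,E[2]) → H¹(ℚ_{ℓ₀},E[2]))`).  By gk2-p4 g34's prime-frame trace bit
(`TraceBit.mem_torsionLocalKer_padic_iff_four_dvd_of_prime_frame`: `loc_{ℓ₀} y = 0 ⟺ 4 ∣ a_{ℓ₀}`) `SteerAt` implies the steering binder, and
`kFourNeg_conclusion_of_wallRows_U2_of_steerBinder` concludes.  So LINE 38's composition needs neither its stub H nor H₂: S1 (steered supply) alone.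
CONDITIONAL on OPEN route items; BSD is NOT proved; K4Neg is NOT proved. [cite: LawsonWuthrich2016, §3, §7.1] [cite: GrossLMS1991, §9 Prop. 9.6]
[cite: McCallumLMS1991, §5 Thm. 5.4] -/
theorem kFourNeg_conclusion_of_wallRows_U2_of_steerAt (hOrd : GoodOrdinaryRankZeroAtTwo)
    (hMult : MultiplicativeRankZeroAtTwo) (hSS : SupersingularRankZeroAtTwo) (hAdd : AdditiveRankZeroAtTwo) (hTw : MinimalTwinBSDTwo)
    (hQ2 : KolyvaginRelationAtTwo) (hGZ : GrossZagierAllLevels) (hGZK : MultPublishedInputsAtTwo) (hL : EntireLFunctionRat)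
    (hMi : MilneAnyModel)
    (W : WeierstrassCurve ℚ) [W.IsElliptic] [W.IsGloballyMinimal] [NeZero (W.conductorNorm ℤ)]
    (hcm : ¬ W.HasCM) (hr0 : W.analyticRank = 0) (hρ : ∀ n : ℕ, 0 < n → W.HasSurjectiveModNGaloisRep ((2 : ℤ) ^ n))
    (hT : Odd W.tamagawaProduct) (hneg : W.Δ < 0) (h4 : Nat.card (W.selmerGroup 2) = 4)
    (K : Type) [Field K] [NumberField K] (hIQ : IsImaginaryQuadratic K) (hodd : Odd (NumberField.discr K))
    (h3 : NumberField.discr K ≠ -3) (hHe : SatisfiesHeegnerHypothesis (W.conductorNorm ℤ) K)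
    (hsq1 : ¬ IsSquare ((NumberField.discr K : ℚ) * -|W.Δ|)) (hsq2 : ¬ IsSquare ((NumberField.discr K : ℚ) * (-(2 * |W.Δ|))))
    (ℓ₀ : ℕ) [Fact ℓ₀.Prime] (hdK : NumberField.discr K = -(ℓ₀ : ℤ))
    (h2K : ((Ideal.span {(2 : ℤ)}).primesOver (𝓞 K)).ncard = 2)
    (Dt : ModularParametrizationData W (W.conductorNorm ℤ))
    (hopt : ∀ z ∈ Dt.L.lattice, ∃ w ∈ periodLattice Dt.f, z = (Dt.c : ℂ) * w) (hc : Odd Dt.c)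
    (β : ℤ) (ι : K →+* ℂ) (d₁ : KolyvaginHeegnerData Dt β ι 1) (hy : ¬ IsOfFinAddOrder d₁.derivedPoint)
    (M₀ : ℕ) (hdiv : ∃ Q : (W.baseChange (ringClassField K ι 1)).toAffine.Point, ((2 ^ M₀ : ℕ) : ℤ) • Q = d₁.derivedPoint)
    (hndiv : ¬ ∃ Q : (W.baseChange (ringClassField K ι 1)).toAffine.Point, ((2 ^ (M₀ + 1) : ℕ) : ℤ) • Q = d₁.derivedPoint)
    (hM₀ : 1 ≤ M₀)
    (Wd : WeierstrassCurve ℚ) [Wd.IsElliptic] [Wd.IsGloballyMinimal]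
    (hWd : ∃ C : VariableChange ℚ, C • W.quadraticTwist (NumberField.discr K : ℚ) = Wd)
    (hrd : Wd.analyticRank = 1) (hSel : Nat.card (Wd.selmerGroup 2) = 2) (hDEF : padicValNat 2 Wd.tamagawaProduct ≤ 1)
    (hSt : ∀ y : galH1Torsion W (2 : ℤ), y ∈ W.selmerGroup 2 → y ≠ 0 →
      (∀ h ∈ torsionFixing W (4 : ℤ), h1Eval W (2 : ℤ) y h = 0) → y ∉ W.torsionLocalKer ℚ_[ℓ₀] (2 : ℤ)) :
    ∃ (n : ℕ) (d : KolyvaginHeegnerData Dt β ι n), Squarefree n ∧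
      (∀ ℓ ∈ n.primeFactors, Zhang2014.IsKolyvaginPrime (W.conductorNorm ℤ) W K 2 ℓ ∧ 2 ≤ Zhang2014.kolyvaginIndex W 2 ℓ ∧
        FrobEqFrobInfty W K 2 ℓ) ∧
      ¬ ∃ Q : (W.baseChange (ringClassField K ι n)).toAffine.Point, (2 : ℤ) • Q = d.derivedPoint := by
  have hℓ₀ : ℓ₀.Prime := Fact.out
  have hs2 : W.HasSurjectiveModNGaloisRep 2 := by simpa using hρ 1 one_pos
  have hs4 : W.HasSurjectiveModNGaloisRep 4 := by have h := hρ 2 two_pos; norm_num at h; exact h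
  obtain ⟨v, 𝔓, γ, hv, -, h𝔓, hγ⟩ := exists_isArithFrobAt_placeOver ℓ₀
  have hℓv : (ℓ₀ : 𝓞 ℚ) ∈ v.asIdeal := by
    rw [← hv]
    exact Rat.HeightOneSpectrum.natCast_natGenerator_mem v
  refine kFourNeg_conclusion_of_wallRows_U2_of_steerBinder hOrd hMult hSS hAdd hTw hQ2 hGZ hGZK hL hMi W hcm hr0 hρ hT hneg h4 K hIQ hodd
    h3 hHe hsq1 hsq2 ℓ₀ hℓ₀ hdK h2K Dt hopt hc β ι d₁ hy M₀ hdiv hndiv hM₀ Wd hWd hrd hSel hDEF fun y hyS hy0 hyd hα ↦ hSt y hyS hy0 hyd ?_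
  exact (TraceBit.mem_torsionLocalKer_padic_iff_four_dvd_of_prime_frame W hs2 hs4 hneg hy0 hyd hIQ hodd hHe hdK hℓv h𝔓 hγ).mpr hα

/-- ★ **K4Neg AT A FRAME ⟸ WALL row 1 + U₂ + Q2 + PRINT + LINE 37's `TwinNonPhantomBit Wd`** (body verbatim, the pen's `((2 : ℕ) : ℤ)` /
`((4 : ℕ) : ℤ)` spelling: no non-zero class of `Sel₂(Wd)` dies on `Γ_{ℚ(Wd[4])}`).  By ★★★ `forall_selmer_twist_eq_zero_iff_selmer_dying_imp_not_four_dvd`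
(`𝒩(Wd)` ⟺ the steering binder) and `kFourNeg_conclusion_of_wallRows_U2_of_steerBinder`.  So LINE 37's `𝒩`-branch closes WITHOUT its stubs N1/N2;
the line reduces to its stub P = K4Neg|(β).  CONDITIONAL on OPEN route items; BSD is NOT proved; K4Neg is NOT proved.
[cite: LawsonWuthrich2016, §3, §7.1] [cite: MazurRubin2010, Def. 3.1, Lemma 2.10–2.11, Prop. 3.3] [cite: McCallumLMS1991, §5 Thm. 5.4] -/
theorem kFourNeg_conclusion_of_wallRows_U2_of_twinNonPhantomBit (hOrd : GoodOrdinaryRankZeroAtTwo)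
    (hMult : MultiplicativeRankZeroAtTwo) (hSS : SupersingularRankZeroAtTwo) (hAdd : AdditiveRankZeroAtTwo) (hTw : MinimalTwinBSDTwo)
    (hQ2 : KolyvaginRelationAtTwo) (hGZ : GrossZagierAllLevels) (hGZK : MultPublishedInputsAtTwo) (hL : EntireLFunctionRat)
    (hMi : MilneAnyModel)
    (W : WeierstrassCurve ℚ) [W.IsElliptic] [W.IsGloballyMinimal] [NeZero (W.conductorNorm ℤ)]
    (hcm : ¬ W.HasCM) (hr0 : W.analyticRank = 0) (hρ : ∀ n : ℕ, 0 < n → W.HasSurjectiveModNGaloisRep ((2 : ℤ) ^ n))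
    (hT : Odd W.tamagawaProduct) (hneg : W.Δ < 0) (h4 : Nat.card (W.selmerGroup 2) = 4)
    (K : Type) [Field K] [NumberField K] (hIQ : IsImaginaryQuadratic K) (hodd : Odd (NumberField.discr K))
    (h3 : NumberField.discr K ≠ -3) (hHe : SatisfiesHeegnerHypothesis (W.conductorNorm ℤ) K)
    (hsq1 : ¬ IsSquare ((NumberField.discr K : ℚ) * -|W.Δ|)) (hsq2 : ¬ IsSquare ((NumberField.discr K : ℚ) * (-(2 * |W.Δ|))))
    (ℓ₀ : ℕ) (hℓ₀ : ℓ₀.Prime) (hdK : NumberField.discr K = -(ℓ₀ : ℤ))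
    (h2K : ((Ideal.span {(2 : ℤ)}).primesOver (𝓞 K)).ncard = 2)
    (Dt : ModularParametrizationData W (W.conductorNorm ℤ))
    (hopt : ∀ z ∈ Dt.L.lattice, ∃ w ∈ periodLattice Dt.f, z = (Dt.c : ℂ) * w) (hc : Odd Dt.c)
    (β : ℤ) (ι : K →+* ℂ) (d₁ : KolyvaginHeegnerData Dt β ι 1) (hy : ¬ IsOfFinAddOrder d₁.derivedPoint)
    (M₀ : ℕ) (hdiv : ∃ Q : (W.baseChange (ringClassField K ι 1)).toAffine.Point, ((2 ^ M₀ : ℕ) : ℤ) • Q = d₁.derivedPoint)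
    (hndiv : ¬ ∃ Q : (W.baseChange (ringClassField K ι 1)).toAffine.Point, ((2 ^ (M₀ + 1) : ℕ) : ℤ) • Q = d₁.derivedPoint)
    (hM₀ : 1 ≤ M₀)
    (Wd : WeierstrassCurve ℚ) [Wd.IsElliptic] [Wd.IsGloballyMinimal]
    (hWd : ∃ C : VariableChange ℚ, C • W.quadraticTwist (NumberField.discr K : ℚ) = Wd)
    (hrd : Wd.analyticRank = 1) (hSel : Nat.card (Wd.selmerGroup 2) = 2) (hDEF : padicValNat 2 Wd.tamagawaProduct ≤ 1)
    (hN : ∀ x : galH1Torsion Wd ((2 : ℕ) : ℤ), x ∈ selmerGroup Wd ((2 : ℕ) : ℤ) →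
      (∀ ρ' ∈ torsionFixing Wd ((4 : ℕ) : ℤ), h1Eval Wd ((2 : ℕ) : ℤ) x ρ' = 0) → x = 0) :
    ∃ (n : ℕ) (d : KolyvaginHeegnerData Dt β ι n), Squarefree n ∧
      (∀ ℓ ∈ n.primeFactors, Zhang2014.IsKolyvaginPrime (W.conductorNorm ℤ) W K 2 ℓ ∧ 2 ≤ Zhang2014.kolyvaginIndex W 2 ℓ ∧
        FrobEqFrobInfty W K 2 ℓ) ∧
      ¬ ∃ Q : (W.baseChange (ringClassField K ι n)).toAffine.Point, (2 : ℤ) • Q = d.derivedPoint := by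
  haveI : Fact ℓ₀.Prime := ⟨hℓ₀⟩
  have hs2 : W.HasSurjectiveModNGaloisRep 2 := by simpa using hρ 1 one_pos
  have hs4 : W.HasSurjectiveModNGaloisRep 4 := by have h := hρ 2 two_pos; norm_num at h; exact h
  obtain ⟨C, hC⟩ := hWd
  have e2 : ((2 : ℕ) : ℤ) = (2 : ℤ) := by norm_num
  have e4 : ((4 : ℕ) : ℤ) = (4 : ℤ) := by norm_num
  rw [e2, e4] at hN
  have hsteer := (forall_selmer_twist_eq_zero_iff_selmer_dying_imp_not_four_dvd W hs2 hs4 hneg hIQ hodd hHe h2K hdK hC).mp hN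
  exact kFourNeg_conclusion_of_wallRows_U2_of_steerBinder hOrd hMult hSS hAdd hTw hQ2 hGZ hGZK hL hMi W hcm hr0 hρ hT hneg h4 K hIQ hodd
    h3 hHe hsq1 hsq2 ℓ₀ hℓ₀ hdK h2K Dt hopt hc β ι d₁ hy M₀ hdiv hndiv hM₀ Wd ⟨C, hC⟩ hrd hSel hDEF hsteer

end Summit.BirchSwinnertonDyer.BirchSwinnertonDyer.Theorems.GenusExact.PhantomDescentBit.TwinLevelFour

end
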